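import Mathlib
import Summits.BirchSwinnertonDyer.BirchSwinnertonDyer.Theorems.KatoDescentTamePotSupersingularTameLowerFibreAdjointBricksFiveModels
import Literature.NumberTheory.GaloisRepresentations.AbsGaloisGroupCompact

/-!
# Bricks for the `GL₂(𝔽₅)`-lifting route (T5′), XX: absolute Galois groups — Kato's (12.5.2) VERBATIM
# («the image of `Gal(K̄/K(ζ_∞))` contains a conjugate of `SL₂(ℤ₅)`») from the residual covering alone

Continuation of file XIX (`…AdjointBricksFiveModels`, same namespace). File XIX gives, for a continuous
`ρ : Γ →* GL₂(A)` of a compact group and a closed subgroup `Γ₀ ≤ Γ` containing the commutators,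
`u · φ(SL₂(ℤ₅)) · u⁻¹ ⊆ ρ(Γ₀)`. This file takes `Γ = Γ_K = Gal(K̄/K)` (ANY field `K`; compact by the tree's
`absoluteGaloisGroup_compactSpace`) and `Γ₀ = {σ : σ fixes every root of unity of K̄}` — a closed subgroup
(stabilisers of algebraic elements are open) containing every commutator (Galois automorphisms act on a
root of unity `t` through powers of `t`, hence commute on it): for the two models `A = ℤ₅` and `A = 𝒪_L`,

* `exists_conj_SL2_le_image_absoluteGaloisGroup_padicInt`: a CONTINUOUS `ρ : Γ_K →* GL₂(ℤ₅)` whose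
  reduction `Γ_K → GL₂(𝔽₅)` is onto admits `u ≡ 1 (mod 5)` such that EVERY `u · s · u⁻¹`, `s ∈ SL₂(ℤ₅)`, is
  `ρ σ` for some `σ` fixing all roots of unity — in particular all `5`-power roots of unity
  (`…_kato`: the binder shape of the tree's `Kato2004.ImageContainsSL2`);
* `exists_conj_SL2_le_image_absoluteGaloisGroup_intermediateFieldIntegers`: the same over `𝒪_L` for every
  finite `L/ℚ₅` inside `ℚ̄₅` and every ring map `φ : ℤ₅ → 𝒪_L`.

This is Kato's (12.5.2) (Astérisque 295, Thm. 12.5 (4), p. 222: «There exists an `O_λ`-basis of `T` for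
which the image of `Gal(ℚ̄/ℚ(ζ_{p^∞})) → GL_{O_λ}(T) ≃ GL₂(O_λ)` contains `SL₂(ℤ_p)`») for `p = 5`, the basis
being `u` applied to the given one, derived from the RESIDUAL hypothesis `ρ̄(Γ_K) = GL₂(𝔽₅)` and continuity
ALONE — the `(2, 𝔽₅)` case excluded by [M] (Manoharmayum 2015) — for every lattice over every Δ1 ring of
T-S7r07-1. Route-free, no definitions, nothing about elliptic curves or items 19618/19981 (open).
-/

set_option linter.dupNamespace false

open Matrix IsLocalRing Filter Topology
open scoped MatrixGroups IntermediateField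

namespace Summit.BirchSwinnertonDyer.BirchSwinnertonDyer.Theorems.GL2F5AdjointBricks

section galois

universe u

variable (K : Type u) [Field K]

/-- A Galois automorphism acts on a root of unity `t` of `K̄` through a power of `t`. -/
theorem exists_smul_eq_pow_of_pow_eq_one (σ : Field.absoluteGaloisGroup K) {t : AlgebraicClosure K} {k : ℕ}
    (hk : 0 < k) (ht : t ^ k = 1) : ∃ i : ℕ, σ • t = t ^ i := by
  haveI : NeZero k := ⟨hk.ne'⟩
  have hprim : IsPrimitiveRoot t (orderOf t) := IsPrimitiveRoot.orderOf t
  have hord : 0 < orderOf t := orderOf_pos_iff.2 (isOfFinOrder_iff_pow_eq_one.2 ⟨k, hk, ht⟩)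
  haveI : NeZero (orderOf t) := ⟨hord.ne'⟩
  have hσ : (σ • t) ^ orderOf t = 1 := by
    rw [Field.absoluteGaloisGroup.smul_def, ← map_pow, pow_orderOf_eq_one, map_one]
  obtain ⟨i, -, hi⟩ := hprim.eq_pow_of_pow_eq_one hσ
  exact ⟨i, hi.symm⟩

/-- Two Galois automorphisms commute on every root of unity. -/
theorem smul_smul_comm_of_pow_eq_one (σ τ : Field.absoluteGaloisGroup K) {t : AlgebraicClosure K} {k : ℕ}
    (hk : 0 < k) (ht : t ^ k = 1) : σ • τ • t = τ • σ • t := by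
  obtain ⟨a, ha⟩ := exists_smul_eq_pow_of_pow_eq_one K σ hk ht
  obtain ⟨b, hb⟩ := exists_smul_eq_pow_of_pow_eq_one K τ hk ht
  simp only [Field.absoluteGaloisGroup.smul_def] at ha hb ⊢
  rw [hb, ha, map_pow, map_pow, ha, hb, ← pow_mul, ← pow_mul, mul_comm]

/-- Commutators of Galois automorphisms fix every root of unity. -/
theorem commutator_smul_eq_of_pow_eq_one (σ τ : Field.absoluteGaloisGroup K) {t : AlgebraicClosure K}
    {k : ℕ} (hk : 0 < k) (ht : t ^ k = 1) : (σ * τ * σ⁻¹ * τ⁻¹) • t = t := by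
  rw [mul_smul, mul_smul, mul_smul, smul_smul_comm_of_pow_eq_one K σ⁻¹ τ⁻¹ hk ht, smul_inv_smul,
    smul_inv_smul]

/-- The stabiliser in `Γ_K` of an element of `K̄` is closed (indeed open: it contains the fixing subgroup
of the finite extension `K(t)`). -/
theorem isClosed_setOf_smul_eq (t : AlgebraicClosure K) :
    IsClosed {σ : Field.absoluteGaloisGroup K | σ • t = t} := by
  have hint : IsIntegral K t := Algebra.IsIntegral.isIntegral t
  haveI : FiniteDimensional K K⟮t⟯ := IntermediateField.adjoin.finiteDimensional hint
  have hopen : IsOpen ((MulAction.stabilizer (Field.absoluteGaloisGroup K) t :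
      Subgroup (Field.absoluteGaloisGroup K)) : Set (Field.absoluteGaloisGroup K)) := by
    refine Subgroup.isOpen_mono (H₁ := (K⟮t⟯).fixingSubgroup) ?_
      (IntermediateField.fixingSubgroup_isOpen _)
    intro g hg
    change g • t = t
    exact (IntermediateField.mem_fixingSubgroup_iff _ _).mp hg _ (IntermediateField.mem_adjoin_simple_self K t)
  have hcl := (MulAction.stabilizer (Field.absoluteGaloisGroup K) t).isClosed_of_isOpen hopen
  have e : {σ : Field.absoluteGaloisGroup K | σ • t = t} =
      ((MulAction.stabilizer (Field.absoluteGaloisGroup K) t : Subgroup (Field.absoluteGaloisGroup K)) :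
        Set (Field.absoluteGaloisGroup K)) := by
    ext σ; simp only [Set.mem_setOf_eq, SetLike.mem_coe, MulAction.mem_stabilizer_iff]
  rw [e]; exact hcl

/-- The automorphisms of `K̄/K` fixing every root of unity form a closed set. -/
theorem isClosed_setOf_forall_smul_rootOfUnity :
    IsClosed {σ : Field.absoluteGaloisGroup K |
      ∀ (k : ℕ) (t : AlgebraicClosure K), 0 < k → t ^ k = 1 → σ • t = t} := by
  have e : {σ : Field.absoluteGaloisGroup K |
      ∀ (k : ℕ) (t : AlgebraicClosure K), 0 < k → t ^ k = 1 → σ • t = t} =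
      ⋂ (k : ℕ), ⋂ (t : AlgebraicClosure K), ⋂ (_ : 0 < k), ⋂ (_ : t ^ k = 1),
        {σ : Field.absoluteGaloisGroup K | σ • t = t} := by
    ext σ; simp only [Set.mem_setOf_eq, Set.mem_iInter]
  rw [e]
  exact isClosed_iInter fun k => isClosed_iInter fun t => isClosed_iInter fun _ =>
    isClosed_iInter fun _ => isClosed_setOf_smul_eq K t

/-- **Kato's (12.5.2) from the residual covering, `A = ℤ₅`.** Let `K` be any field and
`ρ : Γ_K → GL₂(ℤ₅)` a CONTINUOUS representation whose reduction `Γ_K → GL₂(𝔽₅)` is onto. Then there is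
`u ∈ GL₂(ℤ₅)` with `u ≡ 1 (mod 5)` such that every `u · s · u⁻¹`, `s ∈ SL₂(ℤ₅)`, equals `ρ σ` for some
`σ ∈ Γ_K` fixing EVERY root of unity of `K̄` (so `σ ∈ Gal(K̄/K(ζ_∞)) ≤ Gal(K̄/K(ζ_{5^∞}))`): in the basis `u·e`
the image of `Gal(K̄/K(ζ_∞))` contains `SL₂(ℤ₅)`. -/
theorem exists_conj_SL2_le_image_absoluteGaloisGroup_padicInt [Fact (Nat.Prime 5)]
    (ρ : Field.absoluteGaloisGroup K →* GL (Fin 2) ℤ_[5]) (hρ : Continuous ρ)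
    (hres : ∀ q : GL (Fin 2) (ZMod 5), ∃ γ : Field.absoluteGaloisGroup K,
      Matrix.GeneralLinearGroup.map PadicInt.toZMod (ρ γ) = q) :
    ∃ u : GL (Fin 2) ℤ_[5], Matrix.GeneralLinearGroup.map PadicInt.toZMod u = 1 ∧
      ∀ s : SL(2, ℤ_[5]), ∃ σ : Field.absoluteGaloisGroup K,
        (∀ (k : ℕ) (t : AlgebraicClosure K), 0 < k → t ^ k = 1 → σ • t = t) ∧
          ρ σ = u * Matrix.SpecialLinearGroup.toGL s * u⁻¹ := by
  haveI : CompactSpace (Field.absoluteGaloisGroup K) :=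
    Literature.NumberTheory.GaloisRepresentations.absoluteGaloisGroup_compactSpace K
  let Γ₀ : Subgroup (Field.absoluteGaloisGroup K) :=
    { carrier := {σ | ∀ (k : ℕ) (t : AlgebraicClosure K), 0 < k → t ^ k = 1 → σ • t = t}
      mul_mem' := fun {a b} ha hb k t hk ht => by
        show (a * b) • t = t
        rw [mul_smul, hb k t hk ht, ha k t hk ht]
      one_mem' := fun k t _ _ => one_smul _ t
      inv_mem' := fun {a} ha k t hk ht => by
        show a⁻¹ • t = t
        conv_lhs => rw [← ha k t hk ht]
        rw [inv_smul_smul] }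
  have hΓ₀ : IsClosed (Γ₀ : Set (Field.absoluteGaloisGroup K)) := isClosed_setOf_forall_smul_rootOfUnity K
  have hcomm : ∀ a b : Field.absoluteGaloisGroup K, a * b * a⁻¹ * b⁻¹ ∈ Γ₀ :=
    fun a b k t hk ht => commutator_smul_eq_of_pow_eq_one K a b hk ht
  obtain ⟨u, hu1, hu⟩ := exists_conj_SL2_le_range_padicInt ρ hρ Γ₀ hΓ₀ hcomm hres
  refine ⟨u, hu1, fun s => ?_⟩
  obtain ⟨σ, hσ, hσs⟩ := Subgroup.mem_map.1 (hu s).2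
  exact ⟨σ, hσ, hσs⟩

/-- **Kato's (12.5.2), binder shape of the tree's `Kato2004.ImageContainsSL2` (`p = 5`).** As
`exists_conj_SL2_le_image_absoluteGaloisGroup_padicInt`, with `σ` fixing every `5`-power root of unity:
`∀ n t, t ^ 5 ^ n = 1 → σ • t = t`. -/
theorem exists_conj_SL2_le_image_absoluteGaloisGroup_padicInt_kato [Fact (Nat.Prime 5)]
    (ρ : Field.absoluteGaloisGroup K →* GL (Fin 2) ℤ_[5]) (hρ : Continuous ρ)
    (hres : ∀ q : GL (Fin 2) (ZMod 5), ∃ γ : Field.absoluteGaloisGroup K,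
      Matrix.GeneralLinearGroup.map PadicInt.toZMod (ρ γ) = q) :
    ∃ u : GL (Fin 2) ℤ_[5], Matrix.GeneralLinearGroup.map PadicInt.toZMod u = 1 ∧
      ∀ s : SL(2, ℤ_[5]), ∃ σ : Field.absoluteGaloisGroup K,
        (∀ (n : ℕ) (t : AlgebraicClosure K), t ^ 5 ^ n = 1 → σ • t = t) ∧
          ρ σ = u * Matrix.SpecialLinearGroup.toGL s * u⁻¹ := by
  obtain ⟨u, hu1, hu⟩ := exists_conj_SL2_le_image_absoluteGaloisGroup_padicInt K ρ hρ hres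
  refine ⟨u, hu1, fun s => ?_⟩
  obtain ⟨σ, hσ, hσs⟩ := hu s
  exact ⟨σ, fun n t ht => hσ (5 ^ n) t (pow_pos (by norm_num) n) ht, hσs⟩

/-- **Kato's (12.5.2) from the residual covering, `A = 𝒪_L`** (every finite `L/ℚ₅` inside `ℚ̄₅`, every
Δ1 ring of T-S7r07-1). Let `K` be any field and `ρ : Γ_K → GL₂(𝒪_L)` a CONTINUOUS representation whose
reduction modulo `𝔪_L` covers `GL₂(𝔽₅)`. Then some `u ∈ GL₂(𝒪_L)`, `u ≡ 1 (mod 𝔪_L)`, has: for every ring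
map `φ : ℤ₅ → 𝒪_L` and every `s ∈ SL₂(ℤ₅)`, `u · φ(s) · u⁻¹ = ρ σ` for some `σ ∈ Γ_K` fixing every root of
unity of `K̄` (in particular every `5`-power root of unity). -/
theorem exists_conj_SL2_le_image_absoluteGaloisGroup_intermediateFieldIntegers [Fact (Nat.Prime 5)]
    (L : IntermediateField ℚ_[5] (PadicAlgCl 5)) [FiniteDimensional ℚ_[5] L]
    (ρ : Field.absoluteGaloisGroup K →*
      GL (Fin 2) (Literature.NumberTheory.GaloisRepresentations.intermediateFieldIntegers 5 L))
    (hρ : Continuous ρ)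
    (hres : ∀ q : GL (Fin 2) (ZMod 5), ∃ γ : Field.absoluteGaloisGroup K, ∀ i j,
      (ρ γ).val i j - ((q.val i j).val : ℕ) ∈
        maximalIdeal (Literature.NumberTheory.GaloisRepresentations.intermediateFieldIntegers 5 L)) :
    ∃ u : GL (Fin 2) (Literature.NumberTheory.GaloisRepresentations.intermediateFieldIntegers 5 L),
      (∀ i j, u.val i j -
        (1 : Matrix (Fin 2) (Fin 2)
          (Literature.NumberTheory.GaloisRepresentations.intermediateFieldIntegers 5 L)) i j ∈
        maximalIdeal (Literature.NumberTheory.GaloisRepresentations.intermediateFieldIntegers 5 L)) ∧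
      ∀ (φ : ℤ_[5] →+* Literature.NumberTheory.GaloisRepresentations.intermediateFieldIntegers 5 L)
        (s : SL(2, ℤ_[5])), ∃ σ : Field.absoluteGaloisGroup K,
        (∀ (k : ℕ) (t : AlgebraicClosure K), 0 < k → t ^ k = 1 → σ • t = t) ∧
          ρ σ = u * Matrix.GeneralLinearGroup.map φ (Matrix.SpecialLinearGroup.toGL s) * u⁻¹ := by
  haveI : CompactSpace (Field.absoluteGaloisGroup K) :=
    Literature.NumberTheory.GaloisRepresentations.absoluteGaloisGroup_compactSpace K
  let Γ₀ : Subgroup (Field.absoluteGaloisGroup K) :=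
    { carrier := {σ | ∀ (k : ℕ) (t : AlgebraicClosure K), 0 < k → t ^ k = 1 → σ • t = t}
      mul_mem' := fun {a b} ha hb k t hk ht => by
        show (a * b) • t = t
        rw [mul_smul, hb k t hk ht, ha k t hk ht]
      one_mem' := fun k t _ _ => one_smul _ t
      inv_mem' := fun {a} ha k t hk ht => by
        show a⁻¹ • t = t
        conv_lhs => rw [← ha k t hk ht]
        rw [inv_smul_smul] }
  have hΓ₀ : IsClosed (Γ₀ : Set (Field.absoluteGaloisGroup K)) := isClosed_setOf_forall_smul_rootOfUnity K
  have hcomm : ∀ a b : Field.absoluteGaloisGroup K, a * b * a⁻¹ * b⁻¹ ∈ Γ₀ :=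
    fun a b k t hk ht => commutator_smul_eq_of_pow_eq_one K a b hk ht
  obtain ⟨u, hu1, hu⟩ := exists_conj_SL2_le_range_intermediateFieldIntegers L ρ hρ Γ₀ hΓ₀ hcomm hres
  refine ⟨u, hu1, fun φ s => ?_⟩
  obtain ⟨σ, hσ, hσs⟩ := Subgroup.mem_map.1 (hu φ s).2
  exact ⟨σ, hσ, hσs⟩

end galois

end Summit.BirchSwinnertonDyer.BirchSwinnertonDyer.Theorems.GL2F5AdjointBricks
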